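import Summits.QuantumFields.BalabanUV.T4Continuum.Support.NE7LoewnerDiagramBVIntensive

/-!
# NE7LoewnerDiagramPlaquetteUnit — row NE7 (node U5), supplier LÖW (ROUTES-NE7.md §L2.2 B3 ∕ §L2.16–§L2.17): the U = 1
# plaquette covariance chain is BOUNDED BY THE IDENTITY — `plaqCov Lc M R j ⪯ 1` for every read-out torus, dimension,
# averaging factor, constraint matrix and level — hence B3-vol′ is DATUM-FREE on the plaquette faces:
# `Σ_j ‖F(plaqCov R j) − F(plaqCov R (j+1))‖ ≤ |E|·Σ_x ‖w x‖` (residual (β-ω) of §L2.16 CLOSED in kernel)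

Cell `pub-balaban`, rung (B)+1 sub-cell t4, lineage `b2b-balaban-t4-ne7-p2` (CRUX PROVER NE7 #2 under the
coordinator ruling «YM redirect», 2026-08-21; generation 55).  PROVENANCE: the statements AND the proofs below are the
NE7 ideation lens 2's scratch kernel `t4/ideate/NE7/lens2-g13/PlaqCovLeOne.lean` (planner-b2b-balaban-t4-ne7-idea-2-
g13-0, sha16 19d4092f0fa8aace, `t4/ROUTES-NE7.md` v3.12 §L2.17 J-1; written under FREEZE (0) as scratch — an ideation
seat files no tree leaf), re-checked on the farm and landed by the row's crux prover with the namespace and this header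
changed and nothing else of substance; the object was priced independently by the crux refuter (`HOME/b2b-balaban-t4-
ne7-refuter/PRICING-NE7.md` v11 §58 F38: «(β-ω) DISCHARGED ON PAPER for the tree's U = 1 plaquette chains: 0 ⪯ plaqCov
⪯ 1, ω_j ≤ 1 ∀ j, M, R, Lc, d»).  Texts: `HOME/t4/b2b-balaban-t4-ne7-p2/g55/ROUTE2-NE7-P2.md` v1.10 §13; the HONEST
LIMITS (ii) of `Support/NE7LoewnerDiagramBVIntensive` (p259107).  HONEST FRAMING (page 1): FIXED FINITE T⁴, rung (B)+1
= existence AND uniqueness of the `ε = L^{−K} → 0` limit of unit-scale averaged expectations, CONDITIONAL on BetaPertH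
and the nine spine estimates (0/9 proved); NOT infinite volume, NOT a mass gap, NOT the Clay problem.  NE7 is NOT PRINTED
in [Balaban1984PropagatorsI]–[Balaban1989LargeFieldII] and NOT proved here.  Everything below is [folklore] finite-
dimensional linear algebra over TREE objects (gan24-p4's `Beta/GAN24/MonotoneTorusPlaquette.plaqCov`, Federbush's
Abelian stability as typed in `B5AverageCurlStokes.sum_normSq_plaq_QvOp_le`); no definition, no cite tag, nothing printed
asserted, no `sorry`.

WHY.  B3-vol′ (`NE7LoewnerDiagramBVIntensive`) bounds the total variation of every diagram functional along a Löwner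
chain by `|E|·δ^{|E|}·‖w‖₁` from ONE diagonal datum `δ`; on the plaquette chains its instances
(`tsum_norm_diagram_plaqCov_sub_le_of_variance`, `…softPlaqCov…`) still carry `δ` as a binder (a bound on the head
single-plaquette variances).  §L2.16 J-1b named the residual (β-ω): «the DATUM must be vol-uniform — for the U = 1
plaquette chains this is the statement that the field-strength read-out of the (constrained) massless Gaussian field is
an IR-bounded operator … hand-plausible, O(1) in M, NOT kernel».  It is kernel now: (1) Federbush's stability at block
side `Lc^j` summed over planes gives `Bᴴ B ⪯ hform j` for the read-out `B := curlMat M · sread j` (`readout_le_hform`);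
(2) for the critical column `v = critCov·r`, `r = Bᴴ F`: `⟨F, plaqCov F⟩ = ⟨r, v⟩ = ⟨v, hform v⟩ ≥ ‖B v‖²`, and
`0 ≤ ‖F − B v‖² ≤ ‖F‖² − ⟨r, v⟩` (`plaqCov_le_one`).  Hence every single-plaquette variance is `≤ 1` at every
level, every entry has norm `≤ 1`, the trace is `≤ d²·|Tor M|` (LINEAR in the read-out volume), the soft chain is
`⪯ 1` too, and B3-vol′'s variance binders are discharged by `δ = 1`.  SHARP (hand remark, not in the file): at `j = 0`,
`R = 0`, `plaqCov` is the orthogonal projection onto `ran(curlMat M)`, so `ω = 1` is attained for `d ≥ 2`.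

WHAT IS PROVED ([folklore]).
§1 `quad_readout`, `curlEnergy_sread_le` (Federbush at block side `Lc^j`), **`readout_le_hform`** (`Bᴴ B ⪯ hform j`),
   **`plaqCov_le_one`** (`1 − plaqCov Lc M R j ⪰ 0`), `plaqCov_re_diag_le_one`, `plaqCov_norm_entry_le_one`,
   `plaqCov_re_trace_le_card`.
§2 `softPlaqCov_le_one`, `softPlaqCov_re_diag_le_one`, **`tsum_norm_diagram_plaqCov_sub_le`**,
   **`tsum_norm_diagram_softPlaqCov_sub_le`** (B3-vol′ DATUM-FREE on the hard and soft plaquette chains: TV ≤ |E|·‖w‖₁).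

HONEST LIMITS.  (i) A size ∕ vol-uniformity fact about the U = 1 plaquette read-out of OUR torus avatar (abelian ∕
linearised layer); nothing about Bałaban's propagators with backgrounds, nothing printed instantiated.  (ii) It closes
(β-ω) on the PLAQUETTE (field-strength) faces only; the transverse ∕ constrained-FIELD faces of
`NE7LoewnerDiagramTransverse` need the constrained gap of `hform` on `ker(rows)` ((β-ω)^T, §L2.17 — NOT typed), and
(β-⊗) (non-factorising vertex tensors; PRICING v11 F39: load-bearing for B3-op), (β-1PR), LÖW-res (a)(b)(d)(e), β⁰
(NOT covered) are untouched.  (iii) `‖w‖₁` still carries the volume for extensive multi-vertex sums (class (β)); B3-op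
(priced TRUE as offered, v11 §58, KEEP-AS-LEMMA ∕ DORMANT ∕ 0 seats) is NOT landed here.  NOT NE7 (spine 0/9
unchanged), NOT BetaPertH, NOT summit progress.  HONEST DEPENDENCY: continuum YM on T⁴ ⇐ BetaPertH ∧ nine spine
estimates (0/9 proved); BetaPertH ⇐ (D1) ∧ (D4) ∧ CAP+tail; G-an2-4 gates asym, D1 and NE2/3/4.
-/

noncomputable section

namespace Summit.QuantumFields.BalabanUV.T4Continuum.NE7LoewnerDiagramPlaquetteUnit

open Matrix Finset
open scoped BigOperators ComplexOrder ComplexConjugate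
open Literature.MathematicalPhysics.QuantumFieldTheory.Balaban1983to89
open Literature.MathematicalPhysics.QuantumFieldTheory.Balaban1983to89.B5Prop11Plancherel (Tor fine unitVec)
open Literature.MathematicalPhysics.QuantumFieldTheory.Balaban1983to89.B5Block118 (QvOp)
open Literature.MathematicalPhysics.QuantumFieldTheory.Balaban1983to89.B5AverageCurlStokes (plaq plaq_apply sum_normSq_plaq_QvOp_le)
open Summit.QuantumFields.BalabanUV.Beta.GAN24.MonotoneCoarsen (IsCrit conj_pairing)
open Summit.QuantumFields.BalabanUV.Beta.GAN24.MonotoneCritical (critCov critCov_isHermitian)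
open Summit.QuantumFields.BalabanUV.Beta.GAN24.MonotoneLoewner (norm_apply_sq_le re_diag_nonneg)
open Summit.QuantumFields.BalabanUV.Beta.GAN24.MonotoneTorusTower (curlMat curlMat_mulVec curlEnergy curlEnergy_nonneg Lev sread
  rows scal scal_nonneg hform hform_quad hform_isHermitian hform_posSemidef quad_conjTranspose_mul_self)
open Summit.QuantumFields.BalabanUV.Beta.GAN24.MonotoneTorusPlaquette (plaqCov isCrit_plaquette_column plaqCov_quad_eq_of_isCrit
  plaqCov_posSemidef)

/-! ## §1 The plaquette covariance chain is bounded by the identity -/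

variable {d : ℕ} (Lc : ℕ) [NeZero Lc] (M : Fin d → ℕ) [hM : ∀ μ, NeZero (M μ)]
variable {c : Type*} [Fintype c] [DecidableEq c]

/-- `⟨v, (Bᴴ B) v⟩ = curlEnergy_M (sread j v)` for the plaquette read-out `B = curlMat M * sread j`. [folklore] -/
theorem quad_readout (j : ℕ) (v : Lev Lc M j → ℂ) :
    star v ⬝ᵥ (((curlMat M * sread Lc M j)ᴴ * (curlMat M * sread Lc M j)) *ᵥ v)
      = ((curlEnergy M (sread Lc M j *ᵥ v) : ℝ) : ℂ) := by
  rw [quad_conjTranspose_mul_self, curlEnergy]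
  congr 1
  rw [Fintype.sum_prod_type]
  refine Finset.sum_congr rfl fun μ _ => ?_
  rw [Fintype.sum_prod_type]
  refine Finset.sum_congr rfl fun ν _ => Finset.sum_congr rfl fun x _ => ?_
  rw [← mulVec_mulVec, curlMat_mulVec]

/-- FEDERBUSH AT BLOCK SIDE `Lc ^ j`: `curlEnergy_M (sread j v) ≤ scal j · curlEnergy_{fine (Lc^j) M} v`. [folklore] -/
theorem curlEnergy_sread_le (j : ℕ) (v : Lev Lc M j → ℂ) :
    curlEnergy M (sread Lc M j *ᵥ v) ≤ scal (d := d) Lc j * curlEnergy (fine (Lc ^ j) M) v := by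
  have hL : (0 : ℝ) < (Lc : ℝ) := by exact_mod_cast Nat.pos_of_ne_zero (NeZero.ne Lc)
  have hfed : ((Lc : ℝ) ^ j) ^ d * curlEnergy M (sread Lc M j *ᵥ v)
      ≤ ((Lc : ℝ) ^ j) ^ 2 * curlEnergy (fine (Lc ^ j) M) v := by
    rw [curlEnergy, curlEnergy, Finset.mul_sum, Finset.mul_sum]
    refine Finset.sum_le_sum fun μ _ => ?_
    rw [Finset.mul_sum, Finset.mul_sum]
    refine Finset.sum_le_sum fun ν _ => ?_
    have h := sum_normSq_plaq_QvOp_le (Lc ^ j) M v μ ν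
    rw [Nat.cast_pow] at h
    exact h
  have hscal : scal (d := d) Lc j = ((Lc : ℝ) ^ j) ^ 2 / ((Lc : ℝ) ^ j) ^ d := by
    unfold scal
    rw [div_pow, pow_right_comm _ 2 j, pow_right_comm _ d j]
  rw [hscal, div_mul_eq_mul_div, le_div_iff₀ (by positivity), mul_comm]
  exact hfed

/-- `Bᴴ B ⪯ hform j` for the plaquette read-out `B = curlMat M * sread j`. [folklore] -/
theorem readout_le_hform (j : ℕ) :
    (hform Lc M j - (curlMat M * sread Lc M j)ᴴ * (curlMat M * sread Lc M j)).PosSemidef := by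
  refine PosSemidef.of_dotProduct_mulVec_nonneg
    ((hform_isHermitian Lc M j).sub (Matrix.isHermitian_conjTranspose_mul_self _)) fun v => ?_
  rw [sub_mulVec, dotProduct_sub, hform_quad, quad_readout, ← Complex.ofReal_sub]
  exact Complex.zero_le_real.mpr (sub_nonneg.mpr (curlEnergy_sread_le Lc M j v))

/-- **`plaqCov R j ⪯ 1`.** [folklore] -/
theorem plaqCov_le_one (R : Matrix c (Tor M × Fin d) ℂ) (j : ℕ) :
    ((1 : Matrix (Fin d × Fin d × Tor M) (Fin d × Fin d × Tor M) ℂ) - plaqCov Lc M R j).PosSemidef := by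
  have hP : (plaqCov Lc M R j).IsHermitian := (plaqCov_posSemidef Lc M R j).isHermitian
  refine PosSemidef.of_dotProduct_mulVec_nonneg (isHermitian_one.sub hP) fun F => ?_
  have hc := isCrit_plaquette_column Lc M R j F
  set B := curlMat M * sread Lc M j with hB
  set r := Bᴴ *ᵥ F with hr
  set v := critCov (hform_isHermitian Lc M j) (rows Lc M R j) *ᵥ r with hv
  -- `⟨F, P F⟩ = ⟨r, v⟩`
  have e1 : star F ⬝ᵥ (plaqCov Lc M R j *ᵥ F) = star r ⬝ᵥ v := (plaqCov_quad_eq_of_isCrit Lc M R j F hc).symm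
  -- criticality at `w = v`: `⟨v, r⟩ = ⟨v, H v⟩`
  have e2 : star v ⬝ᵥ r = star v ⬝ᵥ (hform Lc M j *ᵥ v) := by
    have h := hc.2 v hc.1
    rwa [dotProduct_sub, sub_eq_zero] at h
  have e3 : star r ⬝ᵥ v = star v ⬝ᵥ (hform Lc M j *ᵥ v) := by
    calc star r ⬝ᵥ v = star (star v ⬝ᵥ r) := star_dotProduct r v
      _ = star (star v ⬝ᵥ (hform Lc M j *ᵥ v)) := by rw [e2]
      _ = star (hform Lc M j *ᵥ v) ⬝ᵥ v := (star_dotProduct (hform Lc M j *ᵥ v) v).symm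
      _ = star v ⬝ᵥ ((hform Lc M j)ᴴ *ᵥ v) := conj_pairing (hform Lc M j) v v
      _ = star v ⬝ᵥ (hform Lc M j *ᵥ v) := by rw [(hform_isHermitian Lc M j).eq]
  -- `‖B v‖² ≤ ⟨v, H v⟩ = ⟨r, v⟩`
  have hBv : star (B *ᵥ v) ⬝ᵥ (B *ᵥ v) ≤ star r ⬝ᵥ v := by
    rw [e3, conj_pairing, mulVec_mulVec]
    have h := (readout_le_hform Lc M j).dotProduct_mulVec_nonneg v
    rw [sub_mulVec, dotProduct_sub, sub_nonneg] at h
    exact h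
  -- the two cross terms both equal `⟨r, v⟩`
  have e4 : star F ⬝ᵥ (B *ᵥ v) = star r ⬝ᵥ v := by
    show star F ⬝ᵥ (B *ᵥ v) = star (Bᴴ *ᵥ F) ⬝ᵥ v
    rw [conj_pairing, conjTranspose_conjTranspose]
  have e5 : star (B *ᵥ v) ⬝ᵥ F = star r ⬝ᵥ v := by
    rw [conj_pairing]
    show star v ⬝ᵥ r = star r ⬝ᵥ v
    rw [e2, e3]
  -- `0 ≤ ‖F − B v‖²`, expanded
  have hsq : 0 ≤ star (F - B *ᵥ v) ⬝ᵥ (F - B *ᵥ v) := dotProduct_star_self_nonneg _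
  have expand : star (F - B *ᵥ v) ⬝ᵥ (F - B *ᵥ v)
      = star F ⬝ᵥ F - star F ⬝ᵥ (B *ᵥ v) - star (B *ᵥ v) ⬝ᵥ F + star (B *ᵥ v) ⬝ᵥ (B *ᵥ v) := by
    rw [star_sub, sub_dotProduct, dotProduct_sub, dotProduct_sub]; ring
  rw [expand, e4, e5] at hsq
  rw [sub_mulVec, dotProduct_sub, one_mulVec, e1]
  calc (0 : ℂ) ≤ star F ⬝ᵥ F - star r ⬝ᵥ v - star r ⬝ᵥ v + star (B *ᵥ v) ⬝ᵥ (B *ᵥ v) := hsq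
    _ ≤ star F ⬝ᵥ F - star r ⬝ᵥ v - star r ⬝ᵥ v + star r ⬝ᵥ v := add_le_add (le_refl _) hBv
    _ = star F ⬝ᵥ F - star r ⬝ᵥ v := by ring

/-- Corollary: every diagonal entry of `plaqCov R j` has real part `≤ 1`. [folklore] -/
theorem plaqCov_re_diag_le_one (R : Matrix c (Tor M × Fin d) ℂ) (j : ℕ) (a : Fin d × Fin d × Tor M) :
    (plaqCov Lc M R j a a).re ≤ 1 := by
  have h := re_diag_nonneg (plaqCov_le_one Lc M R j) a
  rw [Matrix.sub_apply, Matrix.one_apply_eq, Complex.sub_re, Complex.one_re] at h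
  linarith

/-- Corollary: every entry of `plaqCov R j` has norm `≤ 1`. [folklore] -/
theorem plaqCov_norm_entry_le_one (R : Matrix c (Tor M × Fin d) ℂ) (j : ℕ) (a b : Fin d × Fin d × Tor M) :
    ‖plaqCov Lc M R j a b‖ ≤ 1 := by
  have h := norm_apply_sq_le (plaqCov_posSemidef Lc M R j) a b
  have ha := plaqCov_re_diag_le_one Lc M R j a
  have hb := plaqCov_re_diag_le_one Lc M R j b
  have ha0 := re_diag_nonneg (plaqCov_posSemidef Lc M R j) a
  have hb0 := re_diag_nonneg (plaqCov_posSemidef Lc M R j) b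
  have h1 : ‖plaqCov Lc M R j a b‖ ^ 2 ≤ 1 := h.trans (by nlinarith)
  exact (sq_le_one_iff₀ (norm_nonneg _)).mp h1

/-- Corollary: `re tr plaqCov R j ≤ #(Fin d × Fin d × Tor M)` — linear in the read-out volume. [folklore] -/
theorem plaqCov_re_trace_le_card (R : Matrix c (Tor M × Fin d) ℂ) (j : ℕ) :
    (plaqCov Lc M R j).trace.re ≤ Fintype.card (Fin d × Fin d × Tor M) := by
  rw [Matrix.trace, Complex.re_sum]
  calc ∑ a, (plaqCov Lc M R j a a).re ≤ ∑ _a : Fin d × Fin d × Tor M, (1 : ℝ) :=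
        Finset.sum_le_sum fun a _ => plaqCov_re_diag_le_one Lc M R j a
    _ = Fintype.card (Fin d × Fin d × Tor M) := by simp

/-! ## §2 Junctions: the soft chain, and B3-vol′ DATUM-FREE on the plaquette faces -/

section Junction

open Summit.QuantumFields.BalabanUV.Beta.GAN24.MonotoneTorusSoft (softPlaqCov softPlaqCov_le_plaqCov)
open Summit.QuantumFields.BalabanUV.T4Continuum.NE7LoewnerDiagramBV (diagram)
open Summit.QuantumFields.BalabanUV.T4Continuum.NE7LoewnerDiagramBVIntensive
  (tsum_norm_diagram_plaqCov_sub_le_of_variance tsum_norm_diagram_softPlaqCov_sub_le_of_variance)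

variable {cs : Type*} [Fintype cs] {ch : Type*} [Fintype ch] [DecidableEq ch]
variable {ε ι : Type*} [Fintype ε] [DecidableEq ε] [Fintype ι] [DecidableEq ι]

/-- The SOFT plaquette covariance (weight `a′ ≥ 0` on extra rows) is also `⪯ 1`: `softPlaqCov ⪯ plaqCov R_h ⪯ 1`. [folklore] -/
theorem softPlaqCov_le_one (k : ℕ) (Rs : Matrix cs (Tor M × Fin d) ℂ) {a' : ℝ} (ha' : 0 ≤ a')
    (Rh : Matrix ch (Tor M × Fin d) ℂ) :
    ((1 : Matrix (Fin d × Fin d × Tor M) (Fin d × Fin d × Tor M) ℂ) - softPlaqCov Lc M k Rs a' Rh).PosSemidef := by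
  have h := (plaqCov_le_one Lc M Rh k).add (softPlaqCov_le_plaqCov Lc M k Rs ha' Rh)
  rwa [sub_add_sub_cancel] at h

/-- Every diagonal entry of the soft plaquette covariance has real part `≤ 1`. [folklore] -/
theorem softPlaqCov_re_diag_le_one (k : ℕ) (Rs : Matrix cs (Tor M × Fin d) ℂ) {a' : ℝ} (ha' : 0 ≤ a')
    (Rh : Matrix ch (Tor M × Fin d) ℂ) (a : Fin d × Fin d × Tor M) : (softPlaqCov Lc M k Rs a' Rh a a).re ≤ 1 := by
  have h := re_diag_nonneg (softPlaqCov_le_one Lc M k Rs ha' Rh) a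
  rw [Matrix.sub_apply, Matrix.one_apply_eq, Complex.sub_re, Complex.one_re] at h
  linarith

/-- **B3-vol′ DATUM-FREE on the hard plaquette chain**: `Σ_j ‖F(plaqCov R j) − F(plaqCov R (j+1))‖ ≤ |E| · Σ_x ‖w x‖` for every
read-out torus, `Lc`, `d`, `R`, every finite multigraph and vertex weight — the variance datum of
`NE7LoewnerDiagramBVIntensive.tsum_norm_diagram_plaqCov_sub_le_of_variance` is discharged by `δ = 1`. [folklore] -/
theorem tsum_norm_diagram_plaqCov_sub_le (R : Matrix c (Tor M × Fin d) ℂ) (src tgt : ε → ι)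
    (w : (ι → Fin d × Fin d × Tor M) → ℂ) :
    ∑' j, ‖diagram src tgt w (plaqCov Lc M R j) - diagram src tgt w (plaqCov Lc M R (j + 1))‖ ≤
      (Fintype.card ε : ℝ) * ∑ x : ι → Fin d × Fin d × Tor M, ‖w x‖ := by
  have h := tsum_norm_diagram_plaqCov_sub_le_of_variance Lc M R zero_le_one
    (fun x => plaqCov_re_diag_le_one Lc M R 0 x) src tgt w
  rwa [one_pow, mul_one] at h

/-- **B3-vol′ DATUM-FREE on the soft plaquette chain** (every weight `a′ ≥ 0`). [folklore] -/
theorem tsum_norm_diagram_softPlaqCov_sub_le (Rs : Matrix cs (Tor M × Fin d) ℂ) {a' : ℝ} (ha' : 0 ≤ a')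
    (Rh : Matrix ch (Tor M × Fin d) ℂ) (src tgt : ε → ι) (w : (ι → Fin d × Fin d × Tor M) → ℂ) :
    ∑' k, ‖diagram src tgt w (softPlaqCov Lc M k Rs a' Rh) - diagram src tgt w (softPlaqCov Lc M (k + 1) Rs a' Rh)‖ ≤
      (Fintype.card ε : ℝ) * ∑ x : ι → Fin d × Fin d × Tor M, ‖w x‖ := by
  have h := tsum_norm_diagram_softPlaqCov_sub_le_of_variance Lc M Rs ha' Rh zero_le_one
    (fun x => softPlaqCov_re_diag_le_one Lc M 0 Rs ha' Rh x) src tgt w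
  rwa [one_pow, mul_one] at h

end Junction

end Summit.QuantumFields.BalabanUV.T4Continuum.NE7LoewnerDiagramPlaquetteUnit

end
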